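import Summits.KontsevichZagierPeriods.Zeta5Search.LaiSweepShard

/-!
# `κ₃` sweep certificate — shard file 093 of 127 (shards 651–657 of 889)

HONEST FRAMING. Systematic search; no irrationality claim unless certified. This file only checks,
by `decide +kernel`, shards 651–657 of the order-cell sweep of the `κ₃` point `(74, 2180, 444; δ74)`
(engine `LaiSweepEngine`, soundness `LaiSweepJump/Free/Eval/Shard/Kappa3`; a shard is `⟨regime, n,
p, q, p', q', Lo, Up⟩`: `n` cells from `p/q` to `p'/q'` with integer rate sums in `[Lo, Up]`, `K =
128`, `D = 2^40`). It draws NO conclusion: only the capstone `LaiKappa3SweepCert`, which needs all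
127 shard files, does. Kernel cost of this file ≈ 560 cells × 0.3 s.
-/

namespace Summit.KontsevichZagierPeriods.Zeta5Search.Sweep

set_option maxHeartbeats 100000000 in
/-- Shard 651: 80 cells of regime B from `211/301` to `125/178`.
[cite: Lai2024BallRivoal, §4 Lemma 4.3] -/
theorem shard651 :
    Shard.check 128 (2^40)
      ⟨true, 80, 211, 301, 125, 178, 11961773562909, 17125731615060⟩ = true := by
  decide +kernel

set_option maxHeartbeats 100000000 in
/-- Shard 652: 80 cells of regime B from `125/178` to `261/371`.
[cite: Lai2024BallRivoal, §4 Lemma 4.3] -/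
theorem shard652 :
    Shard.check 128 (2^40)
      ⟨true, 80, 125, 178, 261, 371, 12008881683254, 17211159168058⟩ = true := by
  decide +kernel

set_option maxHeartbeats 100000000 in
/-- Shard 653: 80 cells of regime B from `261/371` to `74/105`.
[cite: Lai2024BallRivoal, §4 Lemma 4.3] -/
theorem shard653 :
    Shard.check 128 (2^40)
      ⟨true, 80, 261, 371, 74, 105, 12005649823137, 17224677573191⟩ = true := by
  decide +kernel

set_option maxHeartbeats 100000000 in
/-- Shard 654: 80 cells of regime B from `74/105` to `221/313`.
[cite: Lai2024BallRivoal, §4 Lemma 4.3] -/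
theorem shard654 :
    Shard.check 128 (2^40)
      ⟨true, 80, 74, 105, 221, 313, 12477538070379, 17921016489270⟩ = true := by
  decide +kernel

set_option maxHeartbeats 100000000 in
/-- Shard 655: 80 cells of regime B from `221/313` to `273/386`.
[cite: Lai2024BallRivoal, §4 Lemma 4.3] -/
theorem shard655 :
    Shard.check 128 (2^40)
      ⟨true, 80, 221, 313, 273, 386, 11273891512558, 16208864766517⟩ = true := by
  decide +kernel

set_option maxHeartbeats 100000000 in
/-- Shard 656: 80 cells of regime B from `273/386` to `299/422`.
[cite: Lai2024BallRivoal, §4 Lemma 4.3] -/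
theorem shard656 :
    Shard.check 128 (2^40)
      ⟨true, 80, 273, 386, 299, 422, 12148445772812, 17484303365343⟩ = true := by
  decide +kernel

set_option maxHeartbeats 100000000 in
/-- Shard 657: 80 cells of regime B from `299/422` to `181/255`.
[cite: Lai2024BallRivoal, §4 Lemma 4.3] -/
theorem shard657 :
    Shard.check 128 (2^40)
      ⟨true, 80, 299, 422, 181, 255, 12097439233824, 17429394126424⟩ = true := by
  decide +kernel

/-- The checked shards of this file, in order. [folklore] -/
def shards093 : List (CheckedShard 128 (2^40)) :=
  [⟨_, shard651⟩, ⟨_, shard652⟩, ⟨_, shard653⟩, ⟨_, shard654⟩, ⟨_, shard655⟩,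
    ⟨_, shard656⟩, ⟨_, shard657⟩]

end Summit.KontsevichZagierPeriods.Zeta5Search.Sweep
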